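import Literature.Probability.RandomPlanarGeometry.HexSAWLowerBound
import Literature.Probability.RandomPlanarGeometry.HexSAWWinding
import Mathlib.Analysis.SpecialFunctions.Trigonometric.Basic
import HarnessLib

/-!
# The parafermionic observable of Duminil-Copin–Smirnov: Lemma 1 and the boundary sum

Topic `Literature/Probability/RandomPlanarGeometry`; fifth support file for the discharge of
`Literature.Probability.RandomPlanarGeometry.SAW.DuminilCopinSmirnov2012_thm1` (`HexSAW.lean`). Source: H. Duminil-Copin, S. Smirnov,
*The connective constant of the honeycomb lattice equals `√(2+√2)`*, Ann. of Math. 175 (2012),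
1653–1665 (arXiv:1007.0575), §2: **Definition 1** ("The parafermionic observable for `a ∈ ∂Ω`,
`z ∈ Ω`, is `F(z) = Σ_{γ ⊂ Ω : a → z} e^{-iσ W_γ(a,z)} x^{ℓ(γ)}`"), **Lemma 1** ("If `x = x_c` and
`σ = 5/8`, then `(p - v)F(p) + (q - v)F(q) + (r - v)F(r) = 0` for every vertex `v ∈ V(Ω)`, where
`p, q, r` are the mid-edges of the three edges adjacent to `v`"), its proof ("with `σ = 5/8` the
complex weight … is a product of terms `λ` or `λ̄` per left or right turn, `λ = exp(-i 5π/24)` …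
walks visiting the three mid-edges can be grouped in pairs … walks visiting one or two mid-edges
can be grouped in triplets … `c(γ₁) + c(γ₂) = (p-v) e^{-iσW} x_c^ℓ (j λ̄⁴ + j̄ λ⁴) = 0` …
`c(γ₁) + c(γ₂) + c(γ₃) = (p-v) e^{-iσW} x_c^ℓ (1 + x_c j λ̄ + x_c j̄ λ) = 0` … Above is the only
place where we use that `x` takes its critical value, `x_c⁻¹ = √(2+√2) = 2cos(π/8)`"), and the
first step of the proof of **Lemma 2** (§3: "Sum the relation (2) over all vertices in
`V(S_{T,L})`. Values at interior mid-edges disappear and we arrive at the identity (5)").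

## Contents (namespace `Literature.Probability.RandomPlanarGeometry.SAW.HV`, coordinate model; walks as in `HexSAWStrip`)

* Constants: `θ₅ = -5π/24`, `lam = λ = e^{iθ₅}`, `omg = ω = e^{iπ/3}` (`j = ω²`, `j̄ = -ω`), with
  `lam_zpow_eight` (`λ⁸ = ω`), `omg_sq` (`ω² = ω - 1`), **`triplet_identity`**
  (`1 + x_c(ω²λ⁻¹ - ωλ) = 0`, i.e. `1 + x_c(jλ̄ + j̄λ) = 0`) and **`pair_identity`**
  (`ω²λ^{n-8} = ωλ^n`, i.e. `jλ̄⁴ + j̄λ⁴ = 0`).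
* `emb`, `edir u v` — the honeycomb lattice embedded in `ℂ = ℝ[ω]` through the oblique frame
  `pos` of `HexSAWWinding` (edge length `√3`; `edir v t / 2 = p - v` for the mid-edge `p` of
  `{v, t}`); `ccw v t`, `cw v t` — the two other neighbours of `v`, with `edir_ccw`/`edir_cw`
  (`× j`, `× j̄`) and `turn_ccw`/`turn_cw` (right/left turn).
* `pwt P = x_c^{ℓ} λ^{pturn P}` — the parafermionic weight (`W = (π/3)·pturn`), `cv v P` — the
  contribution `c(γ)` of a walk to the relation at `v`; the classes `clsOut` (final dart leaves
  `v`: "two mid-edges"), `clsIn` (arrives at unvisited `v`: "one mid-edge"), `clsLoop` (arrives at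
  visited `v`: "three mid-edges").
* Triplets: `IsMidWalk.append_singleton`, `IsMidWalk.dropLast_spec`, **`sum_clsOut_eq`** (the
  bijection walk ↦ its two one-step prolongations), `triplet_sum`, `sum_clsIn_add_clsOut`.
* Pairs: `lw l₁ v l₂` (path `l₁`, then the loop `v → l₂ → v`), `loopRev` (reverse the loop),
  `lw_rev_isMidWalk`, `lw_rev_ne`, **`pturn_lw_rev`** (the two windings differ by `8τ`,
  `τ = ±1` the entrance turn — this is where the topological loop lemma
  `cturn_eq_neg_six_mul_turn` of `HexSAWWinding` enters: the loop closed up is a simple cycle in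
  the upper half-plane and the entrance edge is connected to `a` outside it), `pair_sum`,
  `sum_clsLoop_eq_zero` (a fixed-point-free involution).
* **`vertex_relation`** (Lemma 1) for finite `V ⊆ {x₁ ≥ 0}` entered at `a`;
  `sum_cv_comm`, **`boundary_sum`**: `Σ_{γ nontrivial, final dart leaving V} edir · pwt =
  edir w O` (DCS's (5) with the boundary terms not yet evaluated; used by `HexSAWBoundary`).

## Design

DCS's domains are "simply connected with `a ∈ ∂Ω`"; the only place this is used is the winding
`∓4π/3` of the reversed loop, and we prove it for domains contained in the half-plane
`{x₁ ≥ 0}` with `a` the vertical mid-edge below `O` (which covers all strips `S_{T,L}`): the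
loop lies in the half-plane, the faces at `a` have winding number `0` (`wnd_eq_zero_of_le`), and
the winding number is propagated along the initial segment of the walk
(`wnd_rightFace_pdarts_eq`). The relation is stated with the full edge vectors `edir v t = 2(p-v)`;
the factor `2` is immaterial.
-/

noncomputable section

open Finset Literature.Probability.LatticeModels Literature.Probability.Percolation

namespace Literature.Probability.RandomPlanarGeometry.SAW

namespace HV

/-! ### The complex constants `λ = e^{-i5π/24}`, `ω = e^{iπ/3}` -/

/-- The angle `-5π/24 = -σ · π/3` (`σ = 5/8`): one left turn of the walk multiplies the
parafermionic weight by `λ = e^{-i 5π/24}`. [cite: DuminilCopinSmirnov2012, §2 (after Lemma 1)] -/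
def θ₅ : ℝ := -(5 * Real.pi / 24)

/-- `λ = exp(-i 5π/24)`. [cite: DuminilCopinSmirnov2012, §2 ("λ = exp(-i 5π/24)")] -/
def lam : ℂ := Complex.exp ((θ₅ : ℂ) * Complex.I)

/-- `ω = exp(iπ/3)`, the primitive sixth root of unity generating the triangular lattice frame.
[folklore] -/
def omg : ℂ := Complex.exp (((Real.pi / 3 : ℝ) : ℂ) * Complex.I)

/-- `λ ≠ 0`. [folklore] -/
theorem lam_ne_zero : lam ≠ 0 := Complex.exp_ne_zero _

/-- Integer powers of `λ` as exponentials. [folklore] -/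
theorem lam_zpow (n : ℤ) : lam ^ n = Complex.exp (((n * θ₅ : ℝ)) * Complex.I) := by
  rw [lam, ← Complex.exp_int_mul]
  congr 1
  push_cast
  ring

/-- Real parts of powers of `λ`. [folklore] -/
theorem lam_zpow_re (n : ℤ) : (lam ^ n).re = Real.cos (n * θ₅) := by
  rw [lam_zpow, Complex.exp_ofReal_mul_I_re]

/-- Imaginary parts of powers of `λ`. [folklore] -/
theorem lam_zpow_im (n : ℤ) : (lam ^ n).im = Real.sin (n * θ₅) := by
  rw [lam_zpow, Complex.exp_ofReal_mul_I_im]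

/-- `λ⁸ = ω` (`8 · (-5π/24) = -5π/3 ≡ π/3`). [folklore] -/
theorem lam_zpow_eight : lam ^ (8 : ℤ) = omg := by
  rw [lam_zpow, omg]
  have : ((8 : ℤ) * θ₅ : ℝ) = Real.pi / 3 - 2 * Real.pi := by simp [θ₅]; ring
  rw [this]
  push_cast
  rw [sub_mul, Complex.exp_sub, Complex.exp_two_pi_mul_I, div_one]

/-- `ω³ = -1`. [folklore] -/
theorem omg_pow_three : omg ^ 3 = -1 := by
  rw [omg, ← Complex.exp_nat_mul]
  push_cast
  rw [show (3 : ℂ) * (↑Real.pi / 3 * Complex.I) = Real.pi * Complex.I by ring, Complex.exp_pi_mul_I]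

/-- `ω ≠ -1` (its imaginary part is `sin(π/3) ≠ 0`). [folklore] -/
theorem omg_add_one_ne_zero : omg + 1 ≠ 0 := by
  intro h
  have h1 := congrArg Complex.im h
  rw [Complex.add_im, Complex.one_im, add_zero, omg, Complex.exp_ofReal_mul_I_im, Complex.zero_im,
    Real.sin_pi_div_three] at h1
  have h2 : Real.sqrt 3 = 0 := by linarith
  rw [Real.sqrt_eq_zero'] at h2
  linarith

/-- The minimal equation `ω² = ω - 1`. [folklore] -/
theorem omg_sq : omg ^ 2 = omg - 1 := by
  have h : (omg + 1) * (omg ^ 2 - omg + 1) = 0 := by linear_combination omg_pow_three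
  rcases mul_eq_zero.1 h with h | h
  · exact absurd h omg_add_one_ne_zero
  · linear_combination h

/-- `λ¹⁶ = ω² = ω - 1`. [folklore] -/
theorem lam_zpow_sixteen : lam ^ (16 : ℤ) = omg - 1 := by
  rw [show (16 : ℤ) = 8 + 8 by norm_num, zpow_add₀ lam_ne_zero, lam_zpow_eight, ← sq, omg_sq]

/-- `cos(15 θ) = -cos(π/8)`. [folklore] -/
theorem cos_fifteen_mul : Real.cos (15 * θ₅) = -Real.cos (Real.pi / 8) := by
  rw [show 15 * θ₅ = -(Real.pi / 8 + Real.pi + 2 * Real.pi) by simp only [θ₅]; ring, Real.cos_neg,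
    Real.cos_add_two_pi, Real.cos_add_pi]

/-- `cos(9 θ) = cos(π/8)`. [folklore] -/
theorem cos_nine_mul : Real.cos (9 * θ₅) = Real.cos (Real.pi / 8) := by
  rw [show 9 * θ₅ = Real.pi / 8 - 2 * Real.pi by simp only [θ₅]; ring, Real.cos_sub_two_pi]

/-- `sin(15 θ) = sin(π/8)`. [folklore] -/
theorem sin_fifteen_mul : Real.sin (15 * θ₅) = Real.sin (Real.pi / 8) := by
  rw [show 15 * θ₅ = -(Real.pi / 8 + Real.pi + 2 * Real.pi) by simp only [θ₅]; ring, Real.sin_neg,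
    Real.sin_add_two_pi, Real.sin_add_pi, neg_neg]

/-- `sin(9 θ) = sin(π/8)`. [folklore] -/
theorem sin_nine_mul : Real.sin (9 * θ₅) = Real.sin (Real.pi / 8) := by
  rw [show 9 * θ₅ = Real.pi / 8 - 2 * Real.pi by simp only [θ₅]; ring, Real.sin_sub_two_pi]

/-- `2 x_c cos(π/8) = 1`, i.e. `x_c⁻¹ = √(2+√2) = 2 cos(π/8)`.
[cite: DuminilCopinSmirnov2012, §2 ("x_c⁻¹ = √(2+√2) = 2cos(π/8)")] -/
theorem two_mul_xc_mul_cos : 2 * hexCriticalFugacity * Real.cos (Real.pi / 8) = 1 := by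
  rw [Real.cos_pi_div_eight, hexCriticalFugacity]
  have : 0 < Real.sqrt (2 + Real.sqrt 2) := Real.sqrt_pos.2 (by positivity)
  field_simp

/-- **The triplet identity** `1 + x_c (j λ̄ + j̄ λ) = 0` in the form used here:
`1 + x_c (ω² λ⁻¹ - ω λ) = 0` (`j = ω²`, `j̄ = -ω`, `λ̄ = λ⁻¹`). This is the only place where
`x = x_c` is used. [cite: DuminilCopinSmirnov2012, proof of Lemma 1] -/
theorem triplet_identity :
    1 + (hexCriticalFugacity : ℂ) * (omg ^ 2 * lam ^ (-1 : ℤ) - omg * lam) = 0 := by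
  have e1 : omg ^ 2 * lam ^ (-1 : ℤ) = lam ^ (15 : ℤ) := by
    rw [omg_sq, ← lam_zpow_sixteen, ← zpow_add₀ lam_ne_zero]; norm_num
  have e2 : omg * lam = lam ^ (9 : ℤ) := by
    rw [← lam_zpow_eight, ← zpow_add_one₀ lam_ne_zero]; norm_num
  rw [e1, e2]
  apply Complex.ext
  · simp only [Complex.add_re, Complex.one_re, Complex.mul_re, Complex.ofReal_re, Complex.ofReal_im,
      Complex.sub_re, Complex.sub_im, zero_mul, sub_zero, lam_zpow_re, Complex.zero_re]
    push_cast
    rw [cos_fifteen_mul, cos_nine_mul]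
    linear_combination (-1 : ℝ) * two_mul_xc_mul_cos
  · simp only [Complex.add_im, Complex.one_im, Complex.mul_im, Complex.ofReal_re, Complex.ofReal_im,
      Complex.sub_re, Complex.sub_im, zero_mul, add_zero, zero_add, lam_zpow_im, Complex.zero_im]
    push_cast
    rw [sin_fifteen_mul, sin_nine_mul]
    ring

/-- **The pair identity** `j λ̄⁴ + j̄ λ⁴ = 0` in the form used here: `ω = λ⁸`, i.e.
`ω² λ⁻⁴ = ω λ⁴`. [cite: DuminilCopinSmirnov2012, proof of Lemma 1 ("j λ̄⁴ = -i")] -/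
theorem pair_identity (n : ℤ) : omg ^ 2 * lam ^ (n - 8) - omg * lam ^ n = 0 := by
  rw [← lam_zpow_eight, ← zpow_natCast, ← zpow_mul, ← zpow_add₀ lam_ne_zero,
    ← zpow_add₀ lam_ne_zero, show ((8 : ℤ) * ((2 : ℕ) : ℤ) + (n - 8)) = 8 + n by push_cast; ring,
    sub_self]

/-! ### The embedding: positions in `ℤ[ω]` and directions of darts -/

/-- The embedding `ℤ² → ℂ`, `(a, b) ↦ a + b ω` of the oblique frame. [folklore] -/
def emb (p : ℤ × ℤ) : ℂ := (p.1 : ℂ) + (p.2 : ℂ) * omg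

/-- `emb` is additive. [folklore] -/
@[simp] theorem emb_add (p q : ℤ × ℤ) : emb (p + q) = emb p + emb q := by
  simp only [emb, Prod.fst_add, Prod.snd_add]; push_cast; ring

/-- `emb` is additive. [folklore] -/
@[simp] theorem emb_sub (p q : ℤ × ℤ) : emb (p - q) = emb p - emb q := by
  simp only [emb, Prod.fst_sub, Prod.snd_sub]; push_cast; ring

/-- `emb` is additive. [folklore] -/
@[simp] theorem emb_neg (p : ℤ × ℤ) : emb (-p) = -emb p := by
  simp only [emb, Prod.fst_neg, Prod.snd_neg]; push_cast; ring

/-- Multiplication by `ω² = j` (rotation by `2π/3`) on `ℤ[ω]`-coordinates. [folklore] -/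
def rot2 (p : ℤ × ℤ) : ℤ × ℤ := (-p.1 - p.2, p.1)

/-- Multiplication by `ω⁴ = -ω = j̄` (rotation by `-2π/3`) on `ℤ[ω]`-coordinates. [folklore] -/
def rot4 (p : ℤ × ℤ) : ℤ × ℤ := (p.2, -p.1 - p.2)

/-- `emb (rot2 p) = emb p · ω²`. [folklore] -/
theorem emb_rot2 (p : ℤ × ℤ) : emb (rot2 p) = emb p * omg ^ 2 := by
  have h3 := omg_pow_three
  simp only [emb, rot2]; push_cast
  linear_combination (-(p.1 : ℂ)) * omg_sq - (p.2 : ℂ) * h3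

/-- `emb (rot4 p) = -(emb p · ω)`. [folklore] -/
theorem emb_rot4 (p : ℤ × ℤ) : emb (rot4 p) = -(emb p * omg) := by
  simp only [emb, rot4]; push_cast
  linear_combination (p.2 : ℂ) * omg_sq

/-- **The direction of the dart `u → v`**: the vector `v - u` of the embedded honeycomb lattice
(edge length `√3`), so that `(p - v) = edir v t / 2` for the mid-edge `p` of `{v, t}`.
[cite: DuminilCopinSmirnov2012, Lemma 1 ("(p - v)")] -/
def edir (u v : HV) : ℂ := emb (pos v - pos u)

/-- Reversing a dart negates its direction. [folklore] -/
theorem edir_rev (u v : HV) : edir v u = -edir u v := by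
  rw [edir, edir, ← emb_neg, neg_sub]

/-! ### The two other neighbours: counterclockwise and clockwise successors -/

/-- The neighbour of `v` following `t` counterclockwise around `v`. [folklore] -/
def ccw (v t : HV) : HV :=
  match v with
  | (a, b, false) =>
      if t = (a, b, true) then (a - 1, b, true)
      else if t = (a - 1, b, true) then (a, b - 1, true) else (a, b, true)
  | (a, b, true) =>
      if t = (a, b, false) then (a + 1, b, false)
      else if t = (a + 1, b, false) then (a, b + 1, false) else (a, b, false)

/-- The neighbour of `v` following `t` clockwise around `v`. [folklore] -/
def cw (v t : HV) : HV := ccw v (ccw v t)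

section Local

variable {v t : HV}

/-- `ccw v t` is a neighbour of `v`. [folklore] -/
theorem adj_ccw (v t : HV) : hvGraph.Adj v (ccw v t) := by
  obtain ⟨a, b, c⟩ := v
  cases c <;> simp only [ccw] <;> split_ifs <;> simp [hvGraph_adj, AdjRel]

/-- `cw v t` is a neighbour of `v`. [folklore] -/
theorem adj_cw (v t : HV) : hvGraph.Adj v (cw v t) := adj_ccw v _

/-- `ccw v t ≠ t`. [folklore] -/
theorem ccw_ne (v t : HV) : ccw v t ≠ t := by
  obtain ⟨a, b, c⟩ := v
  cases c <;> simp only [ccw] <;> split_ifs with h1 h2 <;> (try subst h1) <;> (try subst h2) <;>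
    first | exact Ne.symm ‹_› | simp

/-- `cw v t ≠ ccw v t`. [folklore] -/
theorem cw_ne_ccw (v t : HV) : cw v t ≠ ccw v t := ccw_ne v _

/-- Going three times to the counterclockwise successor is the identity on neighbours.
[folklore] -/
theorem ccw_ccw_ccw (h : hvGraph.Adj v t) : ccw v (ccw v (ccw v t)) = t := by
  obtain ⟨a, b, c⟩ := v
  obtain ⟨x, y, z⟩ := t
  cases c <;> cases z <;> simp only [hvGraph_adj, AdjRel] at h <;> simp at h <;>
    rcases h with ⟨rfl, rfl⟩ | ⟨rfl, rfl⟩ | ⟨rfl, rfl⟩ <;> simp [ccw]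

/-- `cw v t ≠ t` for a neighbour `t`. [folklore] -/
theorem cw_ne (h : hvGraph.Adj v t) : cw v t ≠ t := by
  intro e
  have := ccw_ne v (cw v t)
  rw [cw, ccw_ccw_ccw h] at this
  exact this e.symm

/-- The three neighbours of `v` are `t`, `ccw v t`, `cw v t`. [folklore] -/
theorem adj_cases (h : hvGraph.Adj v t) {u : HV} (hu : hvGraph.Adj v u) :
    u = t ∨ u = ccw v t ∨ u = cw v t := by
  obtain ⟨a, b, c⟩ := v
  obtain ⟨x, y, z⟩ := t
  obtain ⟨x', y', z'⟩ := u
  cases c <;> cases z <;> simp only [hvGraph_adj, AdjRel] at h <;> simp at h <;>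
    cases z' <;> simp only [hvGraph_adj, AdjRel] at hu <;> simp at hu <;>
    rcases h with ⟨rfl, rfl⟩ | ⟨rfl, rfl⟩ | ⟨rfl, rfl⟩ <;>
    rcases hu with ⟨rfl, rfl⟩ | ⟨rfl, rfl⟩ | ⟨rfl, rfl⟩ <;> simp [ccw, cw]

/-- Going on to the counterclockwise successor is a right turn. [folklore] -/
theorem turn_ccw (h : hvGraph.Adj v t) : turn t v (ccw v t) = -1 := by
  obtain ⟨a, b, c⟩ := v
  obtain ⟨x, y, z⟩ := t
  cases c <;> cases z <;> simp only [hvGraph_adj, AdjRel] at h <;> simp at h <;>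
    rcases h with ⟨rfl, rfl⟩ | ⟨rfl, rfl⟩ | ⟨rfl, rfl⟩ <;> simp [ccw]

/-- Going on to the clockwise successor is a left turn. [folklore] -/
theorem turn_cw (h : hvGraph.Adj v t) : turn t v (cw v t) = 1 := by
  obtain ⟨a, b, c⟩ := v
  obtain ⟨x, y, z⟩ := t
  cases c <;> cases z <;> simp only [hvGraph_adj, AdjRel] at h <;> simp at h <;>
    rcases h with ⟨rfl, rfl⟩ | ⟨rfl, rfl⟩ | ⟨rfl, rfl⟩ <;> simp [ccw, cw]

/-- The direction to the counterclockwise successor is the direction to `t` rotated by `2π/3`.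
[folklore] -/
theorem pos_ccw (h : hvGraph.Adj v t) : pos (ccw v t) - pos v = rot2 (pos t - pos v) := by
  obtain ⟨a, b, c⟩ := v
  obtain ⟨x, y, z⟩ := t
  cases c <;> cases z <;> simp only [hvGraph_adj, AdjRel] at h <;> simp at h <;>
    rcases h with ⟨rfl, rfl⟩ | ⟨rfl, rfl⟩ | ⟨rfl, rfl⟩ <;>
    simp [ccw, pos, rot2] <;> (try constructor) <;> ring

/-- The direction to the clockwise successor is the direction to `t` rotated by `-2π/3`.
[folklore] -/
theorem pos_cw (h : hvGraph.Adj v t) : pos (cw v t) - pos v = rot4 (pos t - pos v) := by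
  have h1 := pos_ccw h
  have h2 := pos_ccw (adj_ccw v t)
  rw [cw, h2, h1]
  refine Prod.ext ?_ ?_
  all_goals simp only [rot2, rot4]
  all_goals ring

/-- `edir v (ccw v t) = edir v t · ω²` (`= j · edir v t`). [folklore] -/
theorem edir_ccw (h : hvGraph.Adj v t) : edir v (ccw v t) = edir v t * omg ^ 2 := by
  rw [edir, pos_ccw h, emb_rot2, edir]

/-- `edir v (cw v t) = -(edir v t · ω)` (`= j̄ · edir v t`). [folklore] -/
theorem edir_cw (h : hvGraph.Adj v t) : edir v (cw v t) = -(edir v t * omg) := by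
  rw [edir, pos_cw h, emb_rot4, edir]

/-- At a vertex with its three neighbours `s, p, q`: the two ways of arriving at `p` through `v`
turn oppositely. [folklore] -/
theorem turn_eq_neg_turn {s p q : HV} (hs : hvGraph.Adj v s) (hp : hvGraph.Adj v p)
    (hq : hvGraph.Adj v q) (hsp : s ≠ p) (hpq : p ≠ q) (hsq : s ≠ q) :
    turn q v p = -turn s v p := by
  rcases adj_cases hs hp with rfl | rfl | rfl
  · exact absurd rfl hsp
  · rcases adj_cases hs hq with rfl | rfl | rfl
    · exact absurd rfl hsq
    · exact absurd rfl hpq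
    · -- q = cw v s, p = ccw v s = cw v q
      have e : ccw v s = cw v (cw v s) := by rw [cw, cw, ccw_ccw_ccw hs]
      rw [turn_ccw hs, e, turn_cw (adj_cw v s)]
      norm_num
  · rcases adj_cases hs hq with rfl | rfl | rfl
    · exact absurd rfl hsq
    · -- q = ccw v s, p = cw v s = ccw v q
      rw [turn_cw hs]
      exact turn_ccw (adj_ccw v s)
    · exact absurd rfl hpq

/-- At a vertex with its three neighbours `s, p, q`: leaving towards `p` or towards `q` are
opposite turns. [folklore] -/
theorem turn_eq_neg_turn' {s p q : HV} (hs : hvGraph.Adj v s) (hp : hvGraph.Adj v p)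
    (hq : hvGraph.Adj v q) (hsp : s ≠ p) (hpq : p ≠ q) (hsq : s ≠ q) :
    turn s v q = -turn s v p := by
  rw [turn_rev q v s, turn_eq_neg_turn hp hs hq hsp.symm hsq hpq, turn_rev s v p, neg_neg]

end Local

/-! ### Anatomy of mid-edge walks around their final dart -/

section Anatomy

variable {V : Finset HV} {P : List HV}

/-- `prevOf (l ++ [v])` is the last vertex of `w :: l`. [folklore] -/
theorem prevOf_append_singleton (l : List HV) (v : HV) :
    prevOf (l ++ [v]) = (wOut :: l).getLast (List.cons_ne_nil _ _) := by
  simp [prevOf]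

/-- The final dart of a mid-edge walk is an edge. [cite: DuminilCopinSmirnov2012, §1] -/
theorem IsMidWalk.adj_finalDart (hP : IsMidWalk V P) :
    hvGraph.Adj (finalDart P).1 (finalDart P).2 := by
  rcases hP.trivial_or_exists with rfl | ⟨l, u, hl, rfl⟩
  · rw [finalDart_trivial]; exact adj_wOut_hvOrigin
  · rw [finalDart_cons_append hl]
    exact ((isMidWalk_cons_append_iff V hl u).1 hP).2.2.1

/-- The two ends of the final dart differ. [folklore] -/
theorem IsMidWalk.finalDart_fst_ne_snd (hP : IsMidWalk V P) : (finalDart P).1 ≠ (finalDart P).2 :=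
  hvGraph.ne_of_adj hP.adj_finalDart

/-- A mid-edge walk is a list followed by its final dart. [folklore] -/
theorem IsMidWalk.exists_eq_append_finalDart (hP : IsMidWalk V P) :
    ∃ R : List HV, P = R ++ [(finalDart P).1, (finalDart P).2] := by
  rcases hP.trivial_or_exists with rfl | ⟨l, u, hl, rfl⟩
  · exact ⟨[], rfl⟩
  · refine ⟨wOut :: l.dropLast, ?_⟩
    rw [finalDart_cons_append hl]
    conv_lhs => rw [← List.dropLast_append_getLast hl]
    simp

/-- Appending one vertex adds one turn, at the final dart. [cite: DuminilCopinSmirnov2012, proof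
of Lemma 1 ("W_{γ₂}(a,q) = W_{γ₁}(a,p) ∓ π/3")] -/
theorem IsMidWalk.pturn_append_singleton (hP : IsMidWalk V P) (t : HV) :
    pturn (P ++ [t]) = pturn P + turn (finalDart P).1 (finalDart P).2 t := by
  obtain ⟨R, hR⟩ := hP.exists_eq_append_finalDart
  generalize (finalDart P).1 = y at hR ⊢
  generalize (finalDart P).2 = z at hR ⊢
  subst hR
  rw [List.append_assoc, List.cons_append, List.cons_append, List.nil_append,
    pturn_append_cons_cons, pturn_cons₃, pturn_two, add_zero]

/-- **Prolonging a walk by one step** ("γ₂ and γ₃ extend γ₁ to q and r"): if `γ` ends at the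
mid-edge `p` of `v` arriving from outside `v` (final dart `(t, v)`, `v` not yet visited), then
for each other neighbour `t'` of `v ∈ V` the list `γ ++ [t']` is a walk with final dart
`(v, t')`, one more vertex and one more turn. [cite: DuminilCopinSmirnov2012, proof of Lemma 1] -/
theorem IsMidWalk.append_singleton (hP : IsMidWalk V P) {v : HV} (hv : (finalDart P).2 = v)
    (hvV : v ∈ V) (hvi : v ∉ inner P) {t' : HV} (ht' : hvGraph.Adj v t')
    (hne : t' ≠ (finalDart P).1) :
    IsMidWalk V (P ++ [t']) ∧ finalDart (P ++ [t']) = (v, t') ∧ mwLen (P ++ [t']) = mwLen P + 1 ∧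
      inner (P ++ [t']) = inner P ++ [v] := by
  rcases hP.trivial_or_exists with rfl | ⟨l, u, hl, rfl⟩
  · rw [finalDart_trivial] at hv hne
    simp only at hv hne
    subst hv
    have e : [wOut, hvOrigin] ++ [t'] = wOut :: ([hvOrigin] ++ [t']) := rfl
    rw [e, finalDart_cons_append (List.cons_ne_nil _ _), mwLen_cons_append, inner_cons_append]
    refine ⟨(isMidWalk_cons_append_iff V (List.cons_ne_nil _ _) t').2
      ⟨List.isChain_singleton _, rfl, by simpa using ht', by simpa using hvV, List.nodup_singleton _,
        by simpa [prevOf] using hne⟩, by simp, by simp, by simp [inner]⟩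
  · rw [finalDart_cons_append hl] at hv hne
    simp only at hv hne
    subst hv
    rw [inner_cons_append] at hvi
    obtain ⟨hc, hh, hadj, hlV, hnd, -⟩ := (isMidWalk_cons_append_iff V hl _).1 hP
    have hl' : l ++ [u] ≠ [] := by simp
    have e : wOut :: (l ++ [u]) ++ [t'] = wOut :: ((l ++ [u]) ++ [t']) := by simp
    rw [e, finalDart_cons_append hl', mwLen_cons_append, mwLen_cons_append, inner_cons_append,
      inner_cons_append]
    refine ⟨(isMidWalk_cons_append_iff V hl' t').2 ⟨?_, ?_, by simpa using ht', ?_, ?_, ?_⟩,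
      by simp, by simp, rfl⟩
    · rw [List.isChain_append]
      refine ⟨hc, List.isChain_singleton _, fun x hx y hy => ?_⟩
      rw [List.getLast?_eq_some_getLast hl, Option.mem_def, Option.some_inj] at hx
      simp only [List.head?_cons, Option.mem_def, Option.some_inj] at hy
      subst hx; subst hy; exact hadj
    · rwa [List.head?_append_of_ne_nil _ hl]
    · intro x hx
      rw [List.mem_append, List.mem_singleton] at hx
      rcases hx with hx | rfl
      · exact hlV x hx
      · exact hvV
    · rw [List.nodup_append]
      exact ⟨hnd, List.nodup_singleton _, fun x hx y hy => by
        rw [List.mem_singleton] at hy; subst hy; rintro rfl; exact hvi hx⟩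
    · rw [prevOf_append_singleton, List.getLast_cons hl]; exact hne

/-- **Erasing the last step** ("a walk visiting exactly two mid-edges is naturally associated to a
walk visiting only one mid-edge by erasing the last step"): a walk whose final dart leaves
`v ∈ V` is `γ ++ [t']` for the walk `γ = ` its `dropLast`, which arrives at `v` from a
neighbour `t` with `v` unvisited, and `t'` is one of the two other neighbours `ccw v t`,
`cw v t`. [cite: DuminilCopinSmirnov2012, proof of Lemma 1] -/
theorem IsMidWalk.dropLast_spec (hw : wOut ∉ V) {Q : List HV} (hQ : IsMidWalk V Q) {v : HV}
    (hvV : v ∈ V) (hv : (finalDart Q).1 = v) :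
    IsMidWalk V Q.dropLast ∧ (finalDart Q.dropLast).2 = v ∧ v ∉ inner Q.dropLast ∧
      hvGraph.Adj v (finalDart Q.dropLast).1 ∧
      (Q = Q.dropLast ++ [ccw v (finalDart Q.dropLast).1] ∨
        Q = Q.dropLast ++ [cw v (finalDart Q.dropLast).1]) := by
  rcases hQ.trivial_or_exists with rfl | ⟨l, u, hl, rfl⟩
  · rw [finalDart_trivial] at hv; simp only at hv; subst hv; exact absurd hvV hw
  rw [finalDart_cons_append hl] at hv
  simp only at hv
  obtain ⟨hc, hh, hadj, hlV, hnd, hne⟩ := (isMidWalk_cons_append_iff V hl u).1 hQ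
  have hQd : (wOut :: (l ++ [u])).dropLast = wOut :: l := by
    rw [← List.cons_append, List.dropLast_concat]
  rw [hQd]
  obtain ⟨l', rfl⟩ : ∃ l', l = l' ++ [v] := ⟨l.dropLast, by rw [← hv, List.dropLast_append_getLast hl]⟩
  rcases eq_or_ne l' [] with rfl | hl'
  · -- `l = [v]`, `v = O`, the erased walk is the trivial one
    simp only [List.nil_append, List.head?_cons, Option.some.injEq] at hh
    subst hh
    have e0 : wOut :: ([] ++ [hvOrigin]) = [wOut, hvOrigin] := rfl
    rw [e0, finalDart_trivial]
    refine ⟨isMidWalk_trivial V, rfl, by simp [inner], adj_wOut_hvOrigin.symm, ?_⟩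
    have hu : u ≠ wOut := by simpa [prevOf] using hne
    have e1 : wOut :: ([] ++ [hvOrigin] ++ [u]) = [wOut, hvOrigin] ++ [u] := rfl
    rw [e1]
    rcases adj_cases adj_wOut_hvOrigin.symm (by simpa using hadj) with h | h | h
    · exact absurd h hu
    · exact Or.inl (by rw [h])
    · exact Or.inr (by rw [h])
  · -- `l = l' ++ [v]` with `l' ≠ []`
    have hvl' : v ∉ l' := fun h =>
      (List.nodup_append.1 hnd).2.2 v h v (List.mem_singleton_self _) rfl
    have hP : IsMidWalk V (wOut :: (l' ++ [v])) := by
      refine (isMidWalk_cons_append_iff V hl' v).2 ⟨?_, ?_, ?_, fun x hx => hlV x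
        (List.mem_append_left _ hx), hnd.sublist (List.sublist_append_left _ _), ?_⟩
      · exact (List.isChain_append.1 hc).1
      · rwa [List.head?_append_of_ne_nil _ hl'] at hh
      · exact (List.isChain_append.1 hc).2.2 _ (by rw [List.getLast?_eq_some_getLast hl']; rfl) v
          (by simp)
      · intro h
        rcases prevOf_mem l' with h' | h'
        · rw [← h] at h'; subst h'; exact hw hvV
        · rw [← h] at h'; exact hvl' h'
    refine ⟨hP, by rw [finalDart_cons_append hl'], by rwa [inner_cons_append], ?_, ?_⟩
    · rw [finalDart_cons_append hl']
      exact ((List.isChain_append.1 hc).2.2 _ (by rw [List.getLast?_eq_some_getLast hl']; rfl) v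
        (by simp)).symm
    · rw [finalDart_cons_append hl']
      simp only
      have ht : hvGraph.Adj v (l'.getLast hl') :=
        ((List.isChain_append.1 hc).2.2 _ (by rw [List.getLast?_eq_some_getLast hl']; rfl) v
          (by simp)).symm
      have hu : u ≠ l'.getLast hl' := by
        rw [prevOf_append_singleton, List.getLast_cons hl'] at hne; exact hne
      have hadj' : hvGraph.Adj v u := by simpa using hadj
      rcases adj_cases ht hadj' with h | h | h
      · exact absurd h hu
      · exact Or.inl (by simp [h])
      · exact Or.inr (by simp [h])

end Anatomy

/-! ### The parafermionic weight and the contributions to the vertex relation -/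

section Observable

variable {V : Finset HV} {P : List HV} {v : HV}

/-- **The parafermionic weight** `x_c^{ℓ(γ)} e^{-iσ W_γ(a,z)}` of a walk `γ` from `a` (`σ = 5/8`):
with the winding `W = (π/3) · pturn` (total rotation of the direction from the starting
half-edge `a` to the final half-edge), `e^{-iσW} = λ^{pturn}`.
[cite: DuminilCopinSmirnov2012, Definition 1] -/
def pwt (P : List HV) : ℂ := (hexCriticalFugacity : ℂ) ^ mwLen P * lam ^ pturn P

/-- The contribution `c(γ)` of a walk to the left-hand side `(p-v)F(p) + (q-v)F(q) + (r-v)F(r)`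
of the vertex relation at `v` (up to the factor `1/2` of `p - v = edir v t / 2`): nonzero only
if the final mid-edge of `γ` is one of the three mid-edges at `v`, i.e. the final dart leaves
`v` or arrives at `v`. [cite: DuminilCopinSmirnov2012, proof of Lemma 1 ("c(γ)")] -/
def cv (v : HV) (P : List HV) : ℂ :=
  ((if (finalDart P).1 = v then edir v (finalDart P).2 else 0) +
    (if (finalDart P).2 = v then edir v (finalDart P).1 else 0)) * pwt P

variable (V v) in
/-- Walks whose final half-edge leaves `v` ("visiting exactly two mid-edges" of `v`).
[cite: DuminilCopinSmirnov2012, proof of Lemma 1] -/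
def clsOut : Finset (List HV) := (midWalks V).filter fun P => (finalDart P).1 = v

variable (V v) in
/-- Walks whose final half-edge arrives at `v` not visited before ("visiting only one
mid-edge" of `v`). [cite: DuminilCopinSmirnov2012, proof of Lemma 1] -/
def clsIn : Finset (List HV) := (midWalks V).filter fun P => (finalDart P).2 = v ∧ v ∉ inner P

variable (V v) in
/-- Walks whose final half-edge arrives at `v` visited before ("visiting all three mid-edges":
a self-avoiding path plus a loop from `v` to `v`). [cite: DuminilCopinSmirnov2012, proof of Lemma 1] -/
def clsLoop : Finset (List HV) := (midWalks V).filter fun P => (finalDart P).2 = v ∧ v ∈ inner P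

/-- Splitting the left-hand side of the vertex relation according to the three classes.
[cite: DuminilCopinSmirnov2012, proof of Lemma 1] -/
theorem sum_cv_eq (V : Finset HV) (v : HV) : ∑ P ∈ midWalks V, cv v P =
    ∑ P ∈ clsOut V v, edir v (finalDart P).2 * pwt P +
      (∑ P ∈ clsIn V v, edir v (finalDart P).1 * pwt P +
        ∑ P ∈ clsLoop V v, edir v (finalDart P).1 * pwt P) := by
  have h1 : ∀ P ∈ midWalks V, cv v P =
      (if (finalDart P).1 = v then edir v (finalDart P).2 * pwt P else 0) +
      ((if (finalDart P).2 = v ∧ v ∉ inner P then edir v (finalDart P).1 * pwt P else 0) +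
        (if (finalDart P).2 = v ∧ v ∈ inner P then edir v (finalDart P).1 * pwt P else 0)) := by
    intro P hP
    have hne := (mem_midWalks_iff.1 hP).finalDart_fst_ne_snd
    unfold cv
    by_cases ha : (finalDart P).1 = v
    · have hb : (finalDart P).2 ≠ v := fun hb => hne (ha.trans hb.symm)
      simp [ha, hb]
    · by_cases hb : (finalDart P).2 = v
      · by_cases hc : v ∈ inner P <;> simp [ha, hb, hc]
      · simp [ha, hb]
  rw [sum_congr rfl h1, sum_add_distrib, sum_add_distrib, clsOut, clsIn, clsLoop, sum_filter,
    sum_filter, sum_filter]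

/-- **Grouping in triplets**: the walks leaving `v ∈ V` are exactly the one-step prolongations,
to the two other neighbours, of the walks arriving at `v` for the first time.
[cite: DuminilCopinSmirnov2012, proof of Lemma 1 ("walks visiting one or two mid-edges can be
grouped in triplets")] -/
theorem sum_clsOut_eq (hw : wOut ∉ V) (hvV : v ∈ V) (f : List HV → ℂ) :
    ∑ Q ∈ clsOut V v, f Q =
      ∑ P ∈ clsIn V v, (f (P ++ [ccw v (finalDart P).1]) + f (P ++ [cw v (finalDart P).1])) := by
  classical
  set e₁ : List HV → List HV := fun P => P ++ [ccw v (finalDart P).1] with he₁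
  set e₂ : List HV → List HV := fun P => P ++ [cw v (finalDart P).1] with he₂
  have hmem : ∀ P ∈ clsIn V v, e₁ P ∈ clsOut V v ∧ e₂ P ∈ clsOut V v := by
    intro P hP
    rw [clsIn, mem_filter, mem_midWalks_iff] at hP
    obtain ⟨hP, hv, hvi⟩ := hP
    have ht : hvGraph.Adj v (finalDart P).1 := hv ▸ hP.adj_finalDart.symm
    have h₁ := hP.append_singleton hv hvV hvi (adj_ccw v _) (ccw_ne v _)
    have h₂ := hP.append_singleton hv hvV hvi (adj_cw v _) (cw_ne ht)
    simp only [clsOut, mem_filter, mem_midWalks_iff, he₁, he₂]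
    exact ⟨⟨h₁.1, by rw [h₁.2.1]⟩, ⟨h₂.1, by rw [h₂.2.1]⟩⟩
  have hcover : clsOut V v = (clsIn V v).image e₁ ∪ (clsIn V v).image e₂ := by
    ext Q
    simp only [mem_union, mem_image]
    constructor
    · intro hQ
      rw [clsOut, mem_filter, mem_midWalks_iff] at hQ
      obtain ⟨hP, hP2, hPi, -, hor⟩ := hQ.1.dropLast_spec hw hvV hQ.2
      have hPm : Q.dropLast ∈ clsIn V v := by
        rw [clsIn, mem_filter, mem_midWalks_iff]; exact ⟨hP, hP2, hPi⟩
      rcases hor with h | h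
      · exact Or.inl ⟨_, hPm, h.symm⟩
      · exact Or.inr ⟨_, hPm, h.symm⟩
    · rintro (⟨P, hP, rfl⟩ | ⟨P, hP, rfl⟩)
      · exact (hmem P hP).1
      · exact (hmem P hP).2
  have hinj₁ : Set.InjOn e₁ (clsIn V v) := fun P _ P' _ h => by
    simpa [he₁, List.dropLast_concat] using congrArg List.dropLast h
  have hinj₂ : Set.InjOn e₂ (clsIn V v) := fun P _ P' _ h => by
    simpa [he₂, List.dropLast_concat] using congrArg List.dropLast h
  have hdisj : Disjoint ((clsIn V v).image e₁) ((clsIn V v).image e₂) := by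
    rw [disjoint_left]
    rintro Q h h'
    obtain ⟨P, -, rfl⟩ := mem_image.1 h
    obtain ⟨P', -, hQ⟩ := mem_image.1 h'
    have h1 : P' = P := by simpa [he₁, he₂, List.dropLast_concat] using congrArg List.dropLast hQ
    subst h1
    have h2 := congrArg List.getLast? hQ
    simp only [he₁, he₂, List.getLast?_append, List.getLast?_singleton, Option.some_or,
      Option.some.injEq] at h2
    exact cw_ne_ccw _ _ h2
  rw [hcover, sum_union hdisj, sum_image hinj₁, sum_image hinj₂, ← sum_add_distrib]

/-- **The sum over a triplet vanishes**: `c(γ₁) + c(γ₂) + c(γ₃) = (p-v) e^{-iσW} x_c^ℓ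
(1 + x_c j λ̄ + x_c j̄ λ) = 0`. [cite: DuminilCopinSmirnov2012, proof of Lemma 1] -/
theorem triplet_sum (hvV : v ∈ V) (hP : P ∈ clsIn V v) :
    edir v (finalDart P).1 * pwt P +
      (edir v (finalDart (P ++ [ccw v (finalDart P).1])).2 * pwt (P ++ [ccw v (finalDart P).1]) +
        edir v (finalDart (P ++ [cw v (finalDart P).1])).2 * pwt (P ++ [cw v (finalDart P).1])) =
      0 := by
  rw [clsIn, mem_filter, mem_midWalks_iff] at hP
  obtain ⟨hP, hv, hvi⟩ := hP
  have ht : hvGraph.Adj v (finalDart P).1 := hv ▸ hP.adj_finalDart.symm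
  obtain ⟨-, f₁, m₁, -⟩ := hP.append_singleton hv hvV hvi (adj_ccw v _) (ccw_ne v _)
  obtain ⟨-, f₂, m₂, -⟩ := hP.append_singleton hv hvV hvi (adj_cw v _) (cw_ne ht)
  have p₁ := hP.pturn_append_singleton (ccw v (finalDart P).1)
  have p₂ := hP.pturn_append_singleton (cw v (finalDart P).1)
  rw [hv, turn_ccw ht] at p₁
  rw [hv, turn_cw ht] at p₂
  simp only [pwt, f₁, f₂, m₁, m₂, p₁, p₂, edir_ccw ht, edir_cw ht, pow_succ,
    zpow_add₀ lam_ne_zero, zpow_neg_one, zpow_one]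
  have ti := triplet_identity
  rw [zpow_neg_one] at ti
  linear_combination
    (edir v (finalDart P).1 * (hexCriticalFugacity : ℂ) ^ mwLen P * lam ^ pturn P) * ti

/-- **Triplets contribute zero**: the classes "one mid-edge" and "two mid-edges" together.
[cite: DuminilCopinSmirnov2012, proof of Lemma 1] -/
theorem sum_clsIn_add_clsOut (hw : wOut ∉ V) (hvV : v ∈ V) :
    ∑ P ∈ clsIn V v, edir v (finalDart P).1 * pwt P +
      ∑ P ∈ clsOut V v, edir v (finalDart P).2 * pwt P = 0 := by
  rw [sum_clsOut_eq hw hvV, ← sum_add_distrib]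
  exact sum_eq_zero fun P hP => triplet_sum hvV hP

end Observable

/-! ### Grouping in pairs: reversing the loop through `v` -/

section Pairs

variable {V : Finset HV} {P : List HV} {v : HV}

/-- The walk with initial segment `l₁`, loop vertex `v` and loop body `l₂`: it visits
`l₁`, then `v`, then `l₂`, and ends at the mid-edge between the last vertex of `l₂` and `v`
("a self-avoiding path plus (up to a half-edge) a self-avoiding loop from `v` to `v`").
[cite: DuminilCopinSmirnov2012, proof of Lemma 1] -/
def lw (l₁ : List HV) (v : HV) (l₂ : List HV) : List HV := wOut :: (l₁ ++ v :: l₂ ++ [v])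

/-- The vertex from which a loop walk enters `v` (`w` if `l₁ = []`, i.e. `v = O`). [folklore] -/
def lwS (l₁ : List HV) : HV := (wOut :: l₁).getLast (List.cons_ne_nil _ _)

/-- Splitting a list at a letter occurring in neither prefix is unique. [folklore] -/
theorem split_unique {v : HV} : ∀ {l₁ m₁ l₂ m₂ : List HV}, v ∉ l₁ → v ∉ m₁ →
    l₁ ++ v :: l₂ = m₁ ++ v :: m₂ → l₁ = m₁ ∧ l₂ = m₂
  | [], [], _, _, _, _, h => by simpa using h
  | [], b :: m₁, _, _, _, hm, h => by
    simp only [List.nil_append, List.cons_append, List.cons.injEq] at h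
    obtain ⟨rfl, -⟩ := h
    exact absurd List.mem_cons_self hm
  | a :: l₁, [], _, _, hl, _, h => by
    simp only [List.nil_append, List.cons_append, List.cons.injEq] at h
    obtain ⟨rfl, -⟩ := h
    exact absurd List.mem_cons_self hl
  | a :: l₁, b :: m₁, _, _, hl, hm, h => by
    simp only [List.cons_append, List.cons.injEq] at h
    obtain ⟨rfl, h⟩ := h
    obtain ⟨h1, h2⟩ := split_unique (List.not_mem_of_not_mem_cons hl)
      (List.not_mem_of_not_mem_cons hm) h
    exact ⟨by rw [h1], h2⟩

open Classical in
/-- **The partner walk**: the same edges, the loop from `v` to `v` explored in the other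
direction (identity on lists not of loop form). [cite: DuminilCopinSmirnov2012, proof of Lemma 1
("the walk passing through the same edges, but exploring the loop from v to v in the other
direction")] -/
def loopRev (v : HV) (P : List HV) : List HV :=
  if h : ∃ l₁ l₂ : List HV, v ∉ l₁ ∧ P = lw l₁ v l₂ then
    lw h.choose v (h.choose_spec.choose).reverse
  else P

/-- The partner of `lw l₁ v l₂` is `lw l₁ v l₂.reverse`. [cite: DuminilCopinSmirnov2012, proof of
Lemma 1] -/
theorem loopRev_lw {l₁ l₂ : List HV} (hv : v ∉ l₁) : loopRev v (lw l₁ v l₂) = lw l₁ v l₂.reverse := by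
  have h : ∃ m₁ m₂ : List HV, v ∉ m₁ ∧ lw l₁ v l₂ = lw m₁ v m₂ := ⟨l₁, l₂, hv, rfl⟩
  rw [loopRev, dif_pos h]
  obtain ⟨hm, he⟩ := h.choose_spec.choose_spec
  have he' : l₁ ++ v :: l₂ = h.choose ++ v :: h.choose_spec.choose :=
    List.append_cancel_right (List.cons.inj he).2
  obtain ⟨e1, e2⟩ := split_unique hv hm he'
  rw [← e2, ← e1]

/-- `prevOf (m ++ [y, z]) = y`. [folklore] -/
theorem prevOf_append_pair (m : List HV) (y z : HV) : prevOf (m ++ [y, z]) = y := by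
  rw [show m ++ [y, z] = (m ++ [y]) ++ [z] by simp, prevOf_append_singleton]
  simp

/-- Splitting off the last turn of a path. [folklore] -/
theorem pturn_concat_turn (L : List HV) (hL : L ≠ []) (y z : HV) :
    pturn (L ++ [y, z]) = pturn (L ++ [y]) + turn (L.getLast hL) y z := by
  obtain ⟨L', x, rfl⟩ : ∃ L' x, L = L' ++ [x] := by
    rcases L.eq_nil_or_concat' with rfl | ⟨L', x, rfl⟩
    · exact absurd rfl hL
    · exact ⟨L', x, rfl⟩
  have e1 : L' ++ [x] ++ [y, z] = L' ++ x :: y :: [z] := by simp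
  have e2 : L' ++ [x] ++ [y] = L' ++ [x, y] := by simp
  rw [e1, e2, pturn_append_cons_cons, pturn_cons₃, pturn_two, add_zero, List.getLast_concat]

/-- The darts of a chain are edges. [folklore] -/
theorem adj_of_mem_pdarts : ∀ {Q : List HV}, Q.IsChain hvGraph.Adj →
    ∀ d ∈ pdarts Q, hvGraph.Adj d.1 d.2
  | [], _, d, hd => by simp at hd
  | [_], _, d, hd => by simp at hd
  | a :: b :: Q, hc, d, hd => by
    rw [pdarts_cons_cons, List.mem_cons] at hd
    rcases hd with rfl | hd
    · exact (List.isChain_cons_cons.1 hc).1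
    · exact adj_of_mem_pdarts (List.isChain_cons_cons.1 hc).2 d hd

/-- `lw` has the mid-edge-walk shape with inner list `l₁ ++ v :: l₂` and exit `v`. [folklore] -/
theorem lw_eq (l₁ : List HV) (v : HV) (l₂ : List HV) : lw l₁ v l₂ = wOut :: ((l₁ ++ v :: l₂) ++ [v]) :=
  rfl

/-- The inner list of a loop walk. [folklore] -/
@[simp] theorem inner_lw (l₁ : List HV) (v : HV) (l₂ : List HV) : inner (lw l₁ v l₂) = l₁ ++ v :: l₂ := by
  rw [lw_eq, inner_cons_append]

/-- The length of a loop walk. [folklore] -/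
@[simp] theorem mwLen_lw (l₁ : List HV) (v : HV) (l₂ : List HV) :
    mwLen (lw l₁ v l₂) = l₁.length + l₂.length + 1 := by
  rw [lw_eq, mwLen_cons_append, List.length_append, List.length_cons, Nat.add_assoc]

/-- The final dart of a loop walk: from the last vertex of the loop body back to `v`. [folklore] -/
theorem finalDart_lw (l₁ : List HV) (v : HV) {l₂ : List HV} (hl₂ : l₂ ≠ []) :
    finalDart (lw l₁ v l₂) = (l₂.getLast hl₂, v) := by
  rw [lw_eq, finalDart_cons_append (by simp), Prod.mk.injEq]
  exact ⟨by rw [List.getLast_append_of_ne_nil _ (List.cons_ne_nil _ _), List.getLast_cons hl₂], rfl⟩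

/-- **The loop body has at least two vertices** (a one-vertex loop would retrace the final
half-edge). [cite: DuminilCopinSmirnov2012, proof of Lemma 1] -/
theorem lw_two_le {l₁ l₂ : List HV} (hP : IsMidWalk V (lw l₁ v l₂)) : 2 ≤ l₂.length := by
  obtain ⟨-, -, hadj, -, -, hne⟩ :=
    (isMidWalk_cons_append_iff V (l := l₁ ++ v :: l₂) (by simp) v).1 hP
  rcases l₂ with _ | ⟨a, _ | ⟨b, r⟩⟩
  · simp at hadj
  · exact absurd (prevOf_append_pair l₁ v a).symm hne
  · simp

/-- The neighbours of `v` seen by a loop walk: the entrance `s = lwS l₁`, the first and the last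
vertex of the loop body; they are three distinct neighbours, and `s` is off the loop. [folklore] -/
theorem lw_nbrs (hV : ∀ w ∈ V, 0 ≤ w.2.1) {l₁ l₂ : List HV} (hP : IsMidWalk V (lw l₁ v l₂))
    (hl₂ : l₂ ≠ []) :
    hvGraph.Adj v (lwS l₁) ∧ hvGraph.Adj v (l₂.head hl₂) ∧ hvGraph.Adj v (l₂.getLast hl₂) ∧
      lwS l₁ ≠ l₂.head hl₂ ∧ l₂.head hl₂ ≠ l₂.getLast hl₂ ∧ lwS l₁ ≠ l₂.getLast hl₂ ∧
      lwS l₁ ∉ v :: l₂ := by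
  obtain ⟨hc, hh, hadj, hlV, hnd, hne⟩ :=
    (isMidWalk_cons_append_iff V (l := l₁ ++ v :: l₂) (by simp) v).1 hP
  have h2 := lw_two_le hP
  obtain ⟨h, r, rfl⟩ := List.exists_cons_of_ne_nil hl₂
  have hr : r ≠ [] := by rintro rfl; simp at h2
  simp only [List.head_cons, List.getLast_cons hr]
  have hc2 : (v :: h :: r).IsChain hvGraph.Adj := (List.isChain_append.1 hc).2.1
  have hvh : hvGraph.Adj v h := (List.isChain_cons_cons.1 hc2).1
  have hgv : hvGraph.Adj (r.getLast hr) v := by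
    have : (l₁ ++ v :: h :: r).getLast (by simp) = r.getLast hr := by
      rw [List.getLast_append_of_ne_nil _ (List.cons_ne_nil _ _), List.getLast_cons (List.cons_ne_nil _ _),
        List.getLast_cons hr]
    rw [← this]; exact hadj
  have hsn : lwS l₁ ∉ v :: h :: r := by
    rcases eq_or_ne l₁ [] with rfl | hl₁
    · intro hm
      have := hV _ (hlV _ (List.mem_append_right _ hm))
      simp [lwS, wOut] at this
    · have hs' : lwS l₁ ∈ l₁ := by
        rw [lwS, List.getLast_cons hl₁]; exact List.getLast_mem hl₁
      intro hm
      exact (List.nodup_append.1 hnd).2.2 _ hs' _ hm rfl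
  have hsv : hvGraph.Adj (lwS l₁) v := by
    rcases eq_or_ne l₁ [] with rfl | hl₁
    · simp only [List.nil_append, List.head?_cons, Option.some.injEq] at hh
      subst hh; exact adj_wOut_hvOrigin
    · rw [lwS, List.getLast_cons hl₁]
      exact (List.isChain_append.1 hc).2.2 _ (by rw [List.getLast?_eq_some_getLast hl₁]; rfl) v
        (by simp)
  have hn2 : (h :: r).Nodup := (List.nodup_cons.1 (List.nodup_append.1 hnd).2.1).2
  refine ⟨hsv.symm, hvh, hgv.symm, fun e => hsn (by simp [e]), fun e => ?_, fun e => hsn ?_, hsn⟩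
  · have : h ∈ r := by rw [e]; exact List.getLast_mem hr
    exact (List.nodup_cons.1 hn2).1 this
  · rw [e]; exact List.mem_cons_of_mem _ (List.mem_cons_of_mem _ (List.getLast_mem hr))

/-- **The partner walk is a walk.** [cite: DuminilCopinSmirnov2012, proof of Lemma 1] -/
theorem lw_rev_isMidWalk {l₁ l₂ : List HV} (hP : IsMidWalk V (lw l₁ v l₂)) :
    IsMidWalk V (lw l₁ v l₂.reverse) := by
  obtain ⟨hc, hh, hadj, hlV, hnd, hne⟩ :=
    (isMidWalk_cons_append_iff V (l := l₁ ++ v :: l₂) (by simp) v).1 hP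
  have h2 := lw_two_le hP
  obtain ⟨a, b, r, rfl⟩ : ∃ a b r, l₂ = a :: b :: r := by
    match l₂, h2 with
    | a :: b :: r, _ => exact ⟨a, b, r, rfl⟩
  have hc2 : (v :: a :: b :: r).IsChain hvGraph.Adj := (List.isChain_append.1 hc).2.1
  refine (isMidWalk_cons_append_iff V (l := l₁ ++ v :: (a :: b :: r).reverse) (by simp) v).2
    ⟨?_, ?_, ?_, ?_, ?_, ?_⟩
  · rw [List.isChain_append]
    refine ⟨(List.isChain_append.1 hc).1, ?_, fun x hx y hy => ?_⟩
    · have e : v :: (a :: b :: r).reverse = ((a :: b :: r) ++ [v]).reverse := by simp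
      rw [e, List.isChain_reverse]
      have h1 : ((v :: a :: b :: r) ++ [v]).IsChain hvGraph.Adj := by
        rw [List.isChain_append]
        refine ⟨hc2, List.isChain_singleton _, fun x hx y hy => ?_⟩
        simp only [List.head?_cons, Option.mem_def, Option.some_inj] at hy
        subst hy
        rw [Option.mem_def, List.getLast?_eq_some_getLast (List.cons_ne_nil _ _), Option.some_inj] at hx
        rw [← hx, ← List.getLast_append_of_ne_nil (l := l₁) (by simp) (List.cons_ne_nil _ _)]
        exact hadj
      have h2 : ((a :: b :: r) ++ [v]).IsChain hvGraph.Adj := by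
        rw [List.cons_append] at h1; exact h1.tail
      exact List.IsChain.imp (fun x y hxy => hxy.symm) h2
    · simp only [List.head?_cons, Option.mem_def, Option.some_inj] at hy
      subst hy
      exact (List.isChain_append.1 hc).2.2 x hx v (by simp)
  · rcases l₁ with _ | ⟨c, l₁⟩ <;> simpa using hh
  · have : (l₁ ++ v :: (a :: b :: r).reverse).getLast (by simp) = a := by simp
    rw [this]; exact (List.isChain_cons_cons.1 hc2).1.symm
  · intro x hx
    apply hlV
    simp only [List.mem_append, List.mem_cons, List.mem_reverse] at hx ⊢
    exact hx
  · have hp : (l₁ ++ v :: (a :: b :: r).reverse).Perm (l₁ ++ v :: a :: b :: r) :=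
      List.Perm.append_left _ (List.Perm.cons _ (List.reverse_perm _))
    exact hp.nodup_iff.2 hnd
  · have e : l₁ ++ v :: (a :: b :: r).reverse = (l₁ ++ v :: r.reverse) ++ [b, a] := by simp
    rw [e, prevOf_append_pair]
    have hv2 : v ∉ a :: b :: r := (List.nodup_cons.1 (List.nodup_append.1 hnd).2.1).1
    intro e'; apply hv2; rw [e']; simp

/-- The partner walk differs from the walk (the loop body has two distinct ends). [folklore] -/
theorem lw_rev_ne {l₁ l₂ : List HV} (hP : IsMidWalk V (lw l₁ v l₂)) : lw l₁ v l₂.reverse ≠ lw l₁ v l₂ := by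
  obtain ⟨-, -, -, -, hnd, -⟩ :=
    (isMidWalk_cons_append_iff V (l := l₁ ++ v :: l₂) (by simp) v).1 hP
  have h2 := lw_two_le hP
  obtain ⟨a, b, r, rfl⟩ : ∃ a b r, l₂ = a :: b :: r := by
    match l₂, h2 with
    | a :: b :: r, _ => exact ⟨a, b, r, rfl⟩
  intro e
  have e1 : (a :: b :: r).reverse = a :: b :: r := by
    have := List.append_cancel_right (List.cons.inj e).2
    exact (List.cons.inj (List.append_cancel_left this)).2
  have e2 := congrArg List.head? e1
  rw [List.head?_reverse, List.getLast?_eq_some_getLast (List.cons_ne_nil _ _), List.head?_cons,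
    Option.some_inj, List.getLast_cons (List.cons_ne_nil _ _)] at e2
  have ha : a ∈ b :: r := by rw [← e2]; exact List.getLast_mem _
  have hn : (a :: b :: r).Nodup := (List.nodup_cons.1 (List.nodup_append.1 hnd).2.1).2
  exact (List.nodup_cons.1 hn).1 ha

/-- **The windings of the two partners differ by `8 · (π/3) · (∓1)`**:
`W_{γ₁}(a,q) = W(a,p) - 4π/3`, `W_{γ₂}(a,r) = W(a,p) + 4π/3`. The loop `v → l₂ → v` closed up is
a simple cycle of `ℍ` lying in the upper half-plane, the entrance edge `{s, v}` is outside it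
(its faces are connected to the faces at `a` by the initial segment, which avoids the loop), so
by the loop lemma of `HexSAWWinding` its turning is `∓2π` according as the walk enters it by a
left or a right turn. [cite: DuminilCopinSmirnov2012, proof of Lemma 1 ("we used the fact that
a is on the boundary and Ω is simply connected")] -/
theorem pturn_lw_rev (hV : ∀ w ∈ V, 0 ≤ w.2.1) {l₁ l₂ : List HV} (hP : IsMidWalk V (lw l₁ v l₂))
    (hl₂ : l₂ ≠ []) :
    pturn (lw l₁ v l₂.reverse) = pturn (lw l₁ v l₂) + 8 * turn (lwS l₁) v (l₂.head hl₂) := by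
  obtain ⟨hc, hh, hadj, hlV, hnd, hne⟩ :=
    (isMidWalk_cons_append_iff V (l := l₁ ++ v :: l₂) (by simp) v).1 hP
  obtain ⟨hvs, hvh, hvg, hsh, hhg, hsg, hsn⟩ := lw_nbrs hV hP hl₂
  have h2 := lw_two_le hP
  obtain ⟨h, r, rfl⟩ := List.exists_cons_of_ne_nil hl₂
  have hr : r ≠ [] := by rintro rfl; simp at h2
  simp only [List.head_cons, List.getLast_cons hr] at hvh hvg hsh hhg hsg ⊢
  set s := lwS l₁ with hs_def
  set g := r.getLast hr with hg_def
  set τ := turn s v h with hτ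
  have hc2 : (v :: h :: r).IsChain hvGraph.Adj := (List.isChain_append.1 hc).2.1
  -- the loop is a simple cycle in the upper half plane
  have hlast : (v :: h :: r).getLast (List.cons_ne_nil _ _) = g := by
    rw [List.getLast_cons (List.cons_ne_nil _ _), List.getLast_cons hr]
  have hrl := List.length_pos_of_ne_nil hr
  have hcyc : IsCyc (v :: h :: r) := by
    refine ⟨by simp; omega, (List.nodup_append.1 hnd).2.1, fun d hd => ?_⟩
    rw [cdarts_eq (List.cons_ne_nil _ _), List.mem_append, List.mem_singleton] at hd
    rcases hd with hd | rfl
    · exact adj_of_mem_pdarts hc2 d hd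
    · rw [hlast]; exact hvg.symm
  -- the entrance edge is outside: propagate the winding number from `a` along `w :: l₁ ++ [v]`
  have h0 : wnd (v :: h :: r) (leftFace v s) = 0 := by
    have hQc : (wOut :: (l₁ ++ [v])).IsChain hvGraph.Adj := by
      have e : lw l₁ v (h :: r) = (wOut :: (l₁ ++ [v])) ++ (h :: r ++ [v]) := by simp [lw]
      have hc' := hP.1
      rw [e] at hc'
      exact (List.isChain_append.1 hc').1
    have hQi : ∀ q ∈ (wOut :: (l₁ ++ [v])).tail.dropLast, q ∉ v :: h :: r := by
      intro q hq
      simp only [List.tail_cons, List.dropLast_concat] at hq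
      exact fun hm => (List.nodup_append.1 hnd).2.2 q hq q hm rfl
    have hd : (wOut, (l₁ ++ [v]).head (by simp)) ∈ pdarts (wOut :: (l₁ ++ [v])) := by
      rw [pdarts_cons_of_ne_nil wOut (by simp)]; exact List.mem_cons_self
    have hd' : (s, v) ∈ pdarts (wOut :: (l₁ ++ [v])) := by
      rw [← List.cons_append, pdarts_append_singleton _ (List.cons_ne_nil _ _)]
      exact List.mem_append_right _ (List.mem_singleton_self _)
    have key := wnd_rightFace_pdarts_eq hcyc.2.2 _ hQc hQi _ hd _ hd'
    have hO : (l₁ ++ [v]).head (by simp) = hvOrigin := by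
      rcases eq_or_ne l₁ [] with rfl | hl₁
      · simpa using hh
      · rw [List.head_append_of_ne_nil hl₁]
        rw [List.head?_append_of_ne_nil _ hl₁] at hh
        exact (List.head_eq_iff_head?_eq_some hl₁).2 hh
    simp only [hO, show rightFace wOut hvOrigin = (1, 0) by decide] at key
    have hz : wnd (v :: h :: r) (1, 0) = 0 :=
      wnd_eq_zero_of_le fun w hw => hV w (hlV w (List.mem_append_right _ hw))
    rw [hz] at key
    exact key.symm
  have hct : cturn (v :: h :: r) = -6 * τ :=
    cturn_eq_neg_six_mul_turn hcyc (List.cons_ne_nil _ _) hvs hsn h0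
  -- turns at `v`
  have t1 : turn g v h = -τ := turn_eq_neg_turn hvs hvh hvg hsh hhg hsg
  have t2 : turn s v g = -τ := turn_eq_neg_turn' hvs hvh hvg hsh hhg hsg
  -- splitting the turn sums
  have e1 : pturn (lw l₁ v (h :: r)) = pturn (wOut :: l₁ ++ [v, h]) + pturn (v :: h :: r ++ [v]) := by
    have : lw l₁ v (h :: r) = (wOut :: l₁) ++ v :: h :: (r ++ [v]) := by simp [lw]
    rw [this, pturn_append_cons_cons]
    simp
  have er : (h :: r).reverse = g :: (r.dropLast.reverse ++ [h]) := by
    conv_lhs => rw [← List.dropLast_append_getLast hr]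
    simp [hg_def]
  have e2 : pturn (lw l₁ v (h :: r).reverse) =
      pturn (wOut :: l₁ ++ [v, g]) + pturn (v :: (h :: r).reverse ++ [v]) := by
    have : lw l₁ v (h :: r).reverse = (wOut :: l₁) ++ v :: g :: ((r.dropLast.reverse ++ [h]) ++ [v]) := by
      simp [lw, er]
    rw [this, pturn_append_cons_cons, er]
    simp
  have e3 : pturn (wOut :: l₁ ++ [v, h]) = pturn (wOut :: l₁ ++ [v]) + τ :=
    pturn_concat_turn (wOut :: l₁) (List.cons_ne_nil _ _) v h
  have e4 : pturn (wOut :: l₁ ++ [v, g]) = pturn (wOut :: l₁ ++ [v]) + turn s v g :=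
    pturn_concat_turn (wOut :: l₁) (List.cons_ne_nil _ _) v g
  have e5 : pturn (v :: (h :: r).reverse ++ [v]) = -pturn (v :: h :: r ++ [v]) := by
    rw [← pturn_reverse]; congr 1; simp
  have e6 : cturn (v :: h :: r) = pturn (v :: h :: r ++ [v]) + turn g v h := by
    rw [cturn, show (v :: h :: r).take 2 = [v, h] from rfl,
      pturn_concat_turn (v :: h :: r) (List.cons_ne_nil _ _) v h, hlast]
  rw [e2, e4, e5, e1, e3]
  linarith [hct, t1, t2, e6]

/-- **The sum over a pair vanishes**: `c(γ₁) + c(γ₂) = (p-v) e^{-iσW(a,p)} x_c^ℓ (j λ̄⁴ + j̄ λ⁴) = 0`.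
[cite: DuminilCopinSmirnov2012, proof of Lemma 1] -/
theorem pair_sum (hV : ∀ w ∈ V, 0 ≤ w.2.1) {l₁ l₂ : List HV} (hP : IsMidWalk V (lw l₁ v l₂)) :
    edir v (finalDart (lw l₁ v l₂)).1 * pwt (lw l₁ v l₂) +
      edir v (finalDart (lw l₁ v l₂.reverse)).1 * pwt (lw l₁ v l₂.reverse) = 0 := by
  have h2 := lw_two_le hP
  have hl₂ : l₂ ≠ [] := by rintro rfl; simp at h2
  obtain ⟨hvs, hvh, hvg, hsh, hhg, hsg, -⟩ := lw_nbrs hV hP hl₂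
  have hpt := pturn_lw_rev hV hP hl₂
  rw [finalDart_lw _ _ hl₂, finalDart_lw _ _ (by simpa using hl₂)]
  simp only [List.getLast_reverse, pwt, mwLen_lw, List.length_reverse, hpt]
  rcases adj_cases hvs hvh with e | e | e
  · exact absurd e.symm hsh
  · -- first vertex of the loop is `ccw v s`: a right turn, the last one is `cw v s`
    have e' : l₂.getLast hl₂ = cw v (lwS l₁) := by
      rcases adj_cases hvs hvg with e' | e' | e'
      · exact absurd e'.symm hsg
      · exact absurd (e.trans e'.symm) hhg
      · exact e'
    rw [e, e', turn_ccw hvs, edir_ccw hvs, edir_cw hvs,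
      show pturn (lw l₁ v l₂) + 8 * -1 = pturn (lw l₁ v l₂) - 8 by ring]
    linear_combination
      ((hexCriticalFugacity : ℂ) ^ (l₁.length + l₂.length + 1) * edir v (lwS l₁)) *
        pair_identity (pturn (lw l₁ v l₂))
  · -- first vertex of the loop is `cw v s`: a left turn, the last one is `ccw v s`
    have e' : l₂.getLast hl₂ = ccw v (lwS l₁) := by
      rcases adj_cases hvs hvg with e' | e' | e'
      · exact absurd e'.symm hsg
      · exact e'
      · exact absurd (e.trans e'.symm) hhg
    rw [e, e', turn_cw hvs, edir_ccw hvs, edir_cw hvs, mul_one]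
    have key := pair_identity (pturn (lw l₁ v l₂) + 8)
    rw [Int.add_sub_cancel] at key
    linear_combination ((hexCriticalFugacity : ℂ) ^ (l₁.length + l₂.length + 1) * edir v (lwS l₁)) * key

/-- Every walk of the loop class is of the form `lw l₁ v l₂` with `v ∉ l₁`. [folklore] -/
theorem exists_eq_lw (hP : P ∈ clsLoop V v) : ∃ l₁ l₂ : List HV, v ∉ l₁ ∧ P = lw l₁ v l₂ := by
  rw [clsLoop, mem_filter, mem_midWalks_iff] at hP
  obtain ⟨hP, hv, hvi⟩ := hP
  rcases hP.trivial_or_exists with rfl | ⟨l, u, hl, rfl⟩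
  · simp [inner] at hvi
  rw [finalDart_cons_append hl] at hv
  simp only at hv
  subst hv
  rw [inner_cons_append] at hvi
  obtain ⟨l₁, l₂, rfl⟩ := List.append_of_mem hvi
  have hnd := ((isMidWalk_cons_append_iff V hl _).1 hP).2.2.2.2.1
  exact ⟨l₁, l₂, fun h => (List.nodup_append.1 hnd).2.2 _ h _ List.mem_cons_self rfl, rfl⟩

/-- **Pairs contribute zero**: the class "three mid-edges" sums to zero, by the fixed-point-free
involution `loopRev`. [cite: DuminilCopinSmirnov2012, proof of Lemma 1 ("walks visiting the three
mid-edges can be grouped in pairs")] -/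
theorem sum_clsLoop_eq_zero (hV : ∀ w ∈ V, 0 ≤ w.2.1) (v : HV) :
    ∑ P ∈ clsLoop V v, edir v (finalDart P).1 * pwt P = 0 := by
  refine Finset.sum_involution (fun P _ => loopRev v P) (fun P hP => ?_) (fun P hP _ => ?_)
    (fun P hP => ?_) (fun P hP => ?_)
  · obtain ⟨l₁, l₂, hv₁, rfl⟩ := exists_eq_lw hP
    rw [loopRev_lw hv₁]
    exact pair_sum hV (mem_midWalks_iff.1 (mem_filter.1 hP).1)
  · obtain ⟨l₁, l₂, hv₁, rfl⟩ := exists_eq_lw hP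
    rw [loopRev_lw hv₁]
    exact lw_rev_ne (mem_midWalks_iff.1 (mem_filter.1 hP).1)
  · obtain ⟨l₁, l₂, hv₁, rfl⟩ := exists_eq_lw hP
    have hPw := mem_midWalks_iff.1 (mem_filter.1 hP).1
    have h2 := lw_two_le hPw
    have hl₂ : l₂.reverse ≠ [] := by intro h; rw [List.reverse_eq_nil_iff] at h; subst h; simp at h2
    rw [loopRev_lw hv₁, clsLoop, mem_filter, mem_midWalks_iff, finalDart_lw _ _ hl₂, inner_lw]
    exact ⟨lw_rev_isMidWalk hPw, rfl, by simp⟩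
  · obtain ⟨l₁, l₂, hv₁, rfl⟩ := exists_eq_lw hP
    simp only [loopRev_lw hv₁, List.reverse_reverse]

end Pairs

/-! ### Lemma 1 and the boundary sum -/

section VertexRelation

variable {V : Finset HV}

/-- `w ∉ V` for a domain in the upper half-plane. [folklore] -/
theorem wOut_not_mem_of_upper (hV : ∀ w ∈ V, 0 ≤ w.2.1) : wOut ∉ V := fun h => by
  have := hV _ h; simp [wOut] at this

/-- **Duminil-Copin–Smirnov, Lemma 1** (the vertex relation of the parafermionic observable at
`x = x_c`, `σ = 5/8`): for every vertex `v` of a (finite) domain `V` contained in the upper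
half-plane `{x₁ ≥ 0}` and entered at `a`, `(p-v)F(p) + (q-v)F(q) + (r-v)F(r) = 0`, written as the
vanishing of the sum of the contributions `c(γ)` of all self-avoiding walks `γ ⊂ V` from `a`
ending at one of the three mid-edges `p, q, r` of `v`. (DCS state it for simply connected
domains with `a` on the boundary; the topological input here is supplied by `HexSAWWinding` for
domains in a half-plane with `a` on its boundary line, which covers the strips `S_{T,L}`.)
[cite: DuminilCopinSmirnov2012, Lemma 1] -/
theorem vertex_relation (hV : ∀ w ∈ V, 0 ≤ w.2.1) {v : HV} (hvV : v ∈ V) :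
    ∑ P ∈ midWalks V, cv v P = 0 := by
  rw [sum_cv_eq, sum_clsLoop_eq_zero hV v, add_zero, add_comm]
  exact sum_clsIn_add_clsOut (wOut_not_mem_of_upper hV) hvV

/-- Summing the contributions of one walk over all vertices of `V`: only the two ends of its
final dart matter. [cite: DuminilCopinSmirnov2012, proof of Lemma 2 ("Sum the relation (2) over
all vertices in V(S_{T,L})")] -/
theorem sum_cv_comm (V : Finset HV) (P : List HV) :
    ∑ v ∈ V, cv v P = ((if (finalDart P).1 ∈ V then edir (finalDart P).1 (finalDart P).2 else 0) +
      (if (finalDart P).2 ∈ V then edir (finalDart P).2 (finalDart P).1 else 0)) * pwt P := by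
  simp only [cv, ← sum_mul, sum_add_distrib, sum_ite_eq]

/-- **The boundary identity** obtained by summing Lemma 1 over `V` ("values at interior mid-edges
disappear"): the sum over all nontrivial walks ending on a boundary mid-edge (final dart leaving
`V`) of `(direction of the final half-edge) · x_c^ℓ · e^{-iσW}` equals the direction of the
starting half-edge `a` (the trivial walk, `F(a) = 1`). This is DCS's equation (5) before the
boundary windings are evaluated. [cite: DuminilCopinSmirnov2012, proof of Lemma 2 (eq. (5))] -/
theorem boundary_sum (hV : ∀ w ∈ V, 0 ≤ w.2.1) (hO : hvOrigin ∈ V) :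
    ∑ P ∈ (midWalks V).filter (fun P => P ≠ [wOut, hvOrigin] ∧ (finalDart P).2 ∉ V),
      edir (finalDart P).1 (finalDart P).2 * pwt P = edir wOut hvOrigin := by
  have hw := wOut_not_mem_of_upper hV
  have h0 : ∑ P ∈ midWalks V, ∑ v ∈ V, cv v P = 0 := by
    rw [sum_comm]; exact sum_eq_zero fun v hv => vertex_relation hV hv
  have h1 : ∀ P ∈ midWalks V, ∑ v ∈ V, cv v P =
      (if P = [wOut, hvOrigin] then edir hvOrigin wOut else 0) +
      (if P ≠ [wOut, hvOrigin] ∧ (finalDart P).2 ∉ V then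
        edir (finalDart P).1 (finalDart P).2 * pwt P else 0) := by
    intro P hP
    rw [mem_midWalks_iff] at hP
    rw [sum_cv_comm]
    by_cases ht : P = [wOut, hvOrigin]
    · subst ht
      simp [finalDart_trivial, hw, hO, pwt]
    · have h1 : (finalDart P).1 ∈ V := finalDart_fst_mem hP ht
      by_cases h2 : (finalDart P).2 ∈ V
      · simp only [h1, h2, if_true, ht, if_false, not_true_eq_false, and_false, add_zero,
          ne_eq, not_false_eq_true, edir_rev (finalDart P).1 (finalDart P).2, add_neg_cancel,
          zero_mul]
      · simp [h1, h2, ht]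
  rw [sum_congr rfl h1, sum_add_distrib, sum_ite_eq' (midWalks V) [wOut, hvOrigin],
    if_pos (mem_midWalks_iff.2 (isMidWalk_trivial V)), ← sum_filter] at h0
  rw [edir_rev hvOrigin wOut]
  exact eq_neg_of_add_eq_zero_right h0

end VertexRelation

end HV

end Literature.Probability.RandomPlanarGeometry.SAW
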